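import Mathlib
import Summits.FinalStateConjecture.FinalStateConjecture.Theorems.PhotonSphereChannelsUniformPhotonSphereChannelsRPeelSeed

/-!
# Peeling, file 12: the `t = 0` deficit identity of one rung

Support file for `stub_peel` of the line `crum-peeling-recessive-tower` (crux
`UniformPhotonSphereChannelsR`, stmt-FinalStateConjecture-14074).  This is the ODE shadow of the
energy identity of a rung (file 7), written for the DIFFERENCES `f_k = (θ_k − p_k)(0, ·)`,
`g_k = ∂ₜ(θ_k − p_k)(0, ·)` of the solutions and the tower elements at `t = 0` on the far half-line
`(xf, ∞)`.  Upper (level `k+1`) data `fu, gu` with `fu(xf) = 0`, `gu, fu' ∈ L²(xf, ∞)`,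
`fu/x ∈ L²`; lower (level `k`) data `f` with `f' = W f + gu`, `f(xf) = 0` and `g := fu' + W fu`.
Then (`deficit_rung`) `g, f' ∈ L²`, `f/x ∈ L²` (Hardy for the primitive `f = w ∫_{xf} gu/w`, the
kernel `w(x)/w(y) ≤ 1` far out), both static energies are integrable, and

  `∫_{(xf,∞)} (g² + f'² + U f²) = ∫_{(xf,∞)} (gu² + fu'² + Ũ fu²)`

— both edge terms `W (f² + fu²)` vanish: at `xf` because `f(xf) = fu(xf) = 0`, at `+∞` because
`|x W| ≤ B` and `h(Y)²/Y → 0` for `h' ∈ L²`.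
-/

noncomputable section

-- the doubled `FinalStateConjecture` component is the tree's fixed summit/problem path
set_option linter.dupNamespace false

namespace Summit.FinalStateConjecture.FinalStateConjecture.Theorems.CrumPeelingRecessiveTower

open MeasureTheory Set Filter Topology intervalIntegral

/-- `1/x²` is integrable on `(X, ∞)` for `X > 0`. -/
theorem integrableOn_one_div_sq {X : ℝ} (hX : 0 < X) : IntegrableOn (fun x : ℝ => 1 / x ^ 2) (Ioi X) := by
  have h := integrableOn_Ioi_rpow_of_lt (by norm_num : (-(2 : ℝ)) < -1) hX
  refine h.congr_fun (fun x hx => ?_) measurableSet_Ioi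
  have hx0 : 0 < x := hX.trans hx
  show x ^ (-(2 : ℝ)) = 1 / x ^ 2
  rw [Real.rpow_neg hx0.le, show (2 : ℝ) = ((2 : ℕ) : ℝ) by norm_num, Real.rpow_natCast, one_div]

/-- **Representation of the lower datum**: if `f' = W f + gu` on `(a, ∞)` and `f(xf) = 0`
(`a < xf`), then `f(x) = w(x) ∫_{xf}^x gu/w` for `x > a` (`w' = W w`, `w > 0`). -/
theorem lower_eq_seed_mul_primitive {a xf : ℝ} {W w f df gu : ℝ → ℝ} (haxf : a < xf)
    (hw0 : ∀ x, a < x → 0 < w x) (hwd : ∀ x, a < x → HasDerivAt w (W x * w x) x)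
    (hguc : ContinuousOn gu (Ioi a)) (hf : ∀ x, a < x → HasDerivAt f (df x) x)
    (hdf : ∀ x, a < x → df x = W x * f x + gu x) (hf0 : f xf = 0) {x : ℝ} (hx : a < x) :
    f x = w x * ∫ y in xf..x, gu y / w y := by
  have hwc : ContinuousOn w (Ioi a) := fun y hy => (hwd y hy).continuousAt.continuousWithinAt
  have hqc : ContinuousOn (fun y => gu y / w y) (Ioi a) := hguc.div hwc fun y hy => (hw0 y hy).ne'
  -- `q = f/w − ∫ gu/w` has zero derivative on `(a, ∞)`
  set q : ℝ → ℝ := fun y => f y / w y - ∫ s in xf..y, gu s / w s with hq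
  have hqd : ∀ y, a < y → HasDerivAt q 0 y := by
    intro y hy
    have hwy := (hw0 y hy).ne'
    have h1 : HasDerivAt (fun y => f y / w y) ((df y * w y - f y * (W y * w y)) / w y ^ 2) y :=
      (hf y hy).div (hwd y hy) hwy
    have hint : IntervalIntegrable (fun s => gu s / w s) volume xf y := by
      refine (hqc.mono fun s hs => ?_).intervalIntegrable
      rcases le_total xf y with h | h
      · rw [uIcc_of_le h] at hs; exact haxf.trans_le hs.1
      · rw [uIcc_of_ge h] at hs; exact hy.trans_le hs.1
    have h2 : HasDerivAt (fun y => ∫ s in xf..y, gu s / w s) (gu y / w y) y :=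
      intervalIntegral.integral_hasDerivAt_right hint
        (hqc.stronglyMeasurableAtFilter isOpen_Ioi y hy) (hqc.continuousAt (Ioi_mem_nhds hy))
    have h := h1.sub h2
    have he : (df y * w y - f y * (W y * w y)) / w y ^ 2 - gu y / w y = 0 := by
      rw [hdf y hy]; field_simp; ring
    rw [he] at h
    exact h
  have hqcont : ContinuousOn q (Ioi a) := fun y hy => (hqd y hy).continuousAt.continuousWithinAt
  have hq0 : q xf = 0 := by simp [hq, hf0]
  have hqx : q x = 0 := by
    rcases le_total xf x with h | h
    · have := constant_of_has_deriv_right_zero (hqcont.mono fun y hy => haxf.trans_le hy.1)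
        (fun y hy => (hqd y (haxf.trans_le hy.1)).hasDerivWithinAt) x ⟨h, le_rfl⟩
      rw [this, hq0]
    · have := constant_of_has_deriv_right_zero (hqcont.mono fun y hy => hx.trans_le hy.1)
        (fun y hy => (hqd y (hx.trans_le hy.1)).hasDerivWithinAt) xf ⟨h, le_rfl⟩
      rw [← this, hq0]
  have hwx := (hw0 x hx).ne'
  have : f x / w x = ∫ s in xf..x, gu s / w s := by
    have h := hqx; simp only [hq] at h; linarith
  rw [← this]; field_simp

/-- **The `t = 0` deficit identity of one rung.**  See the module docstring. -/
theorem deficit_rung {a xf X₁ B C : ℝ} {W U Ut w fu dfu gu f df : ℝ → ℝ}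
    (haxf : a < xf) (haX : a < X₁) (hX1 : 1 ≤ X₁)
    (hUc : ContinuousOn U (Ioi a)) (hUtc : ContinuousOn Ut (Ioi a)) (hWc : ContinuousOn W (Ioi a))
    (hWd : ∀ x, a < x → HasDerivAt W (U x - W x ^ 2) x)
    (hUt : ∀ x, a < x → Ut x = 2 * W x ^ 2 - U x)
    (hrec : ∀ x, X₁ ≤ x → x * W x ≤ -3 / 4) (hWB : ∀ x, X₁ ≤ x → |x * W x| ≤ B)
    (hUB : ∀ x, X₁ ≤ x → |x ^ 2 * U x| ≤ C)
    (hw0 : ∀ x, a < x → 0 < w x) (hwd : ∀ x, a < x → HasDerivAt w (W x * w x) x)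
    (hfu : ∀ x, a < x → HasDerivAt fu (dfu x) x) (hdfuc : ContinuousOn dfu (Ioi a))
    (hguc : ContinuousOn gu (Ioi a)) (hfu0 : fu xf = 0)
    (hJ1 : IntegrableOn (fun x => gu x ^ 2) (Ioi xf)) (hJ2 : IntegrableOn (fun x => dfu x ^ 2) (Ioi xf))
    (hJ3 : IntegrableOn (fun x => (fu x / x) ^ 2) (Ioi (max xf 1)))
    (hf : ∀ x, a < x → HasDerivAt f (df x) x) (hdf : ∀ x, a < x → df x = W x * f x + gu x)
    (hf0 : f xf = 0) :
    IntegrableOn (fun x => (dfu x + W x * fu x) ^ 2) (Ioi xf) ∧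
    IntegrableOn (fun x => df x ^ 2) (Ioi xf) ∧
    IntegrableOn (fun x => (f x / x) ^ 2) (Ioi (max xf 1)) ∧
    IntegrableOn (fun x => (dfu x + W x * fu x) ^ 2 + df x ^ 2 + U x * f x ^ 2) (Ioi xf) ∧
    IntegrableOn (fun x => gu x ^ 2 + dfu x ^ 2 + Ut x * fu x ^ 2) (Ioi xf) ∧
    ∫ x in Ioi xf, ((dfu x + W x * fu x) ^ 2 + df x ^ 2 + U x * f x ^ 2)
      = ∫ x in Ioi xf, (gu x ^ 2 + dfu x ^ 2 + Ut x * fu x ^ 2) := by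
  have hX₁0 : 0 < X₁ := by linarith
  set X₂ : ℝ := max X₁ xf with hX₂
  have hX₂1 : X₁ ≤ X₂ := le_max_left _ _
  have hX₂f : xf ≤ X₂ := le_max_right _ _
  have hX₂a : a < X₂ := haxf.trans_le hX₂f
  have hX₂0 : 0 < X₂ := hX₁0.trans_le hX₂1
  have hwc : ContinuousOn w (Ioi a) := fun y hy => (hwd y hy).continuousAt.continuousWithinAt
  have hfc : ContinuousOn f (Ioi a) := fun y hy => (hf y hy).continuousAt.continuousWithinAt
  have hfuc : ContinuousOn fu (Ioi a) := fun y hy => (hfu y hy).continuousAt.continuousWithinAt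
  have hdfc : ContinuousOn df (Ioi a) := ((hWc.mul hfc).add hguc).congr fun x hx => hdf x hx
  -- glue from a far threshold
  have glue : ∀ {h : ℝ → ℝ} {X : ℝ}, a < X → ContinuousOn h (Ioi a) → IntegrableOn h (Ioi X₂) →
      IntegrableOn h (Ioi X) := by
    intro h X hX hhc hhi
    rcases le_or_gt X₂ X with h | h
    · exact hhi.mono_set (Ioi_subset_Ioi h)
    · exact integrableOn_Ioi_of_continuousOn_Icc (hhc.mono fun x hx => lt_of_lt_of_le hX hx.1) hhi
  have hWsq : ∀ x, X₁ ≤ x → ∀ v : ℝ, (W x * v) ^ 2 ≤ B ^ 2 * (v / x) ^ 2 := by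
    intro x hx v
    have hx0 : 0 < x := hX₁0.trans_le hx
    have e : (W x * v) ^ 2 = (x * W x) ^ 2 * (v / x) ^ 2 := by field_simp
    rw [e, ← sq_abs (x * W x)]
    exact mul_le_mul_of_nonneg_right (pow_le_pow_left₀ (abs_nonneg _) (hWB x hx) 2) (sq_nonneg _)
  -- (1) `f/x ∈ L²` beyond `X₂` by Hardy for the primitive
  set K₀ : ℝ := ∫ y in xf..X₂, gu y / w y with hK₀
  set F : ℝ → ℝ := fun x => ∫ y in X₂..x, |gu (max y X₂)| with hF
  have hguX₂ : ContinuousOn gu (Ici X₂) := hguc.mono fun y hy => hX₂a.trans_le hy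
  obtain ⟨hHardy, -⟩ := hardy_primitive hX₂0 hguX₂ (hJ1.mono_set (Ioi_subset_Ioi hX₂f))
  have hanti : AntitoneOn w (Ici X₁) := seed_antitoneOn haX hX₁0 hw0 hwd hrec
  have hfbound : ∀ x, X₂ ≤ x → |f x| ≤ w X₂ * |K₀| + F x := by
    intro x hx
    have hxa : a < x := hX₂a.trans_le hx
    have hwx := hw0 x hxa
    have hrep := lower_eq_seed_mul_primitive haxf hw0 hwd hguc hf hdf hf0 hxa
    have hqc : ContinuousOn (fun y => gu y / w y) (Ioi a) := hguc.div hwc fun y hy => (hw0 y hy).ne'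
    have hi1 : IntervalIntegrable (fun y => gu y / w y) volume xf X₂ :=
      (hqc.mono fun y hy => haxf.trans_le (by rw [uIcc_of_le hX₂f] at hy; exact hy.1)).intervalIntegrable
    have hi2 : IntervalIntegrable (fun y => gu y / w y) volume X₂ x :=
      (hqc.mono fun y hy => hX₂a.trans_le (by rw [uIcc_of_le hx] at hy; exact hy.1)).intervalIntegrable
    rw [← intervalIntegral.integral_add_adjacent_intervals hi1 hi2] at hrep
    -- the far part of the primitive
    have hfar : |w x * ∫ y in X₂..x, gu y / w y| ≤ F x := by
      rw [abs_mul, abs_of_pos hwx]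
      have h1 : |∫ y in X₂..x, gu y / w y| ≤ ∫ y in X₂..x, |gu y| / w x := by
        refine (intervalIntegral.abs_integral_le_integral_abs hx).trans ?_
        refine intervalIntegral.integral_mono_on hx ?_ ?_ fun y hy => ?_
        · exact hi2.abs
        · exact ((hguc.abs.mono fun y hy => hX₂a.trans_le hy.1).div_const _).intervalIntegrable_of_Icc hx
        · have hya : a < y := hX₂a.trans_le hy.1
          rw [abs_div, abs_of_pos (hw0 y hya)]
          exact div_le_div_of_nonneg_left (abs_nonneg _) hwx
            (hanti (hX₂1.trans hy.1) (hX₂1.trans hx) hy.2)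
      have h2 : ∫ y in X₂..x, |gu y| / w x = F x / w x := by
        simp only [hF]
        rw [← intervalIntegral.integral_div]
        refine intervalIntegral.integral_congr fun y hy => ?_
        rw [uIcc_of_le hx] at hy
        rw [max_eq_left hy.1]
      rw [h2] at h1
      calc w x * |∫ y in X₂..x, gu y / w y| ≤ w x * (F x / w x) := mul_le_mul_of_nonneg_left h1 hwx.le
        _ = F x := by field_simp
    rw [hrep, mul_add]
    calc |w x * K₀ + w x * ∫ y in X₂..x, gu y / w y|
        ≤ |w x * K₀| + |w x * ∫ y in X₂..x, gu y / w y| := abs_add_le _ _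
      _ ≤ w X₂ * |K₀| + F x := by
          rw [abs_mul, abs_of_pos hwx]
          exact add_le_add (mul_le_mul_of_nonneg_right (hanti hX₂1 (hX₂1.trans hx) hx) (abs_nonneg _))
            hfar
  have hI3far : IntegrableOn (fun x => (f x / x) ^ 2) (Ioi X₂) := by
    set K₁ : ℝ := w X₂ * |K₀| with hK₁
    have hdom : IntegrableOn (fun x => 2 * K₁ ^ 2 * (1 / x ^ 2) + 2 * ((F x) ^ 2 / x ^ 2)) (Ioi X₂) :=
      (((integrableOn_one_div_sq hX₂0).const_mul (2 * K₁ ^ 2))).add (hHardy.const_mul 2)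
    have hcont : ContinuousOn (fun x => f x / x) (Ioi X₂) :=
      (hfc.mono (Ioi_subset_Ioi hX₂a.le)).div continuousOn_id fun x hx => (hX₂0.trans hx).ne'
    refine hdom.mono' ((hcont.pow 2).aestronglyMeasurable measurableSet_Ioi) ?_
    filter_upwards [ae_restrict_mem measurableSet_Ioi] with x hx
    have hx0 : 0 < x := hX₂0.trans hx
    have hb := hfbound x (le_of_lt hx)
    have hF0 : 0 ≤ F x := intervalIntegral.integral_nonneg (le_of_lt hx) fun y _ => abs_nonneg _
    rw [Real.norm_eq_abs, abs_of_nonneg (sq_nonneg _), div_pow]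
    have h1 : f x ^ 2 ≤ 2 * K₁ ^ 2 + 2 * F x ^ 2 := by
      have : |f x| ^ 2 ≤ (K₁ + F x) ^ 2 := pow_le_pow_left₀ (abs_nonneg _) hb 2
      rw [sq_abs] at this
      nlinarith [sq_nonneg (K₁ - F x)]
    have hx2 : 0 < x ^ 2 := by positivity
    calc f x ^ 2 / x ^ 2 ≤ (2 * K₁ ^ 2 + 2 * F x ^ 2) / x ^ 2 := div_le_div_of_nonneg_right h1 hx2.le
      _ = 2 * K₁ ^ 2 * (1 / x ^ 2) + 2 * (F x ^ 2 / x ^ 2) := by field_simp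
  have hI3 : IntegrableOn (fun x => (f x / x) ^ 2) (Ioi (max xf 1)) := by
    have hm : a < max xf 1 := lt_of_lt_of_le haxf (le_max_left _ _)
    rcases le_or_gt X₂ (max xf 1) with h | h
    · exact hI3far.mono_set (Ioi_subset_Ioi h)
    · refine integrableOn_Ioi_of_continuousOn_Icc (X := X₂) ?_ hI3far
      refine ((hfc.mono fun x hx => hm.trans_le hx.1).div continuousOn_id fun x hx => ?_).pow 2
      exact (lt_of_lt_of_le one_pos ((le_max_right xf 1).trans hx.1)).ne'
  -- (2) the other square-integrable pieces
  have hX₂m : max xf 1 ≤ X₂ := max_le hX₂f (hX1.trans hX₂1)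
  have hJ3' : IntegrableOn (fun x => (fu x / x) ^ 2) (Ioi X₂) := hJ3.mono_set (Ioi_subset_Ioi hX₂m)
  have hgc : ContinuousOn (fun x => dfu x + W x * fu x) (Ioi a) := hdfuc.add (hWc.mul hfuc)
  have hg2 : IntegrableOn (fun x => (dfu x + W x * fu x) ^ 2) (Ioi xf) := by
    refine glue haxf (hgc.pow 2) (integrableOn_sq_of_le hX₂a.le hgc
      (((hJ2.mono_set (Ioi_subset_Ioi hX₂f)).const_mul 2).add ((hJ3'.const_mul (B ^ 2)).const_mul 2))
      fun x hx => ?_)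
    simp only [Pi.add_apply]
    have h := hWsq x (hX₂1.trans (le_of_lt hx)) (fu x)
    nlinarith [sq_nonneg (dfu x - W x * fu x)]
  have hdf2 : IntegrableOn (fun x => df x ^ 2) (Ioi xf) := by
    refine glue haxf (hdfc.pow 2) (integrableOn_sq_of_le hX₂a.le hdfc
      (((hI3far.const_mul (B ^ 2)).const_mul 2).add ((hJ1.mono_set (Ioi_subset_Ioi hX₂f)).const_mul 2))
      fun x hx => ?_)
    simp only [Pi.add_apply]
    rw [hdf x (hX₂a.trans hx)]
    have h := hWsq x (hX₂1.trans (le_of_lt hx)) (f x)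
    nlinarith [sq_nonneg (W x * f x - gu x)]
  have hpot : ∀ {P h : ℝ → ℝ} {C' : ℝ}, ContinuousOn P (Ioi a) → ContinuousOn h (Ioi a) →
      (∀ x, X₁ ≤ x → |x ^ 2 * P x| ≤ C') → IntegrableOn (fun x => (h x / x) ^ 2) (Ioi X₂) →
      IntegrableOn (fun x => P x * h x ^ 2) (Ioi xf) := by
    intro P h C' hPc hhc hPB hh
    refine glue haxf (hPc.mul (hhc.pow 2)) ?_
    refine (hh.const_mul C').mono' (((hPc.mul (hhc.pow 2)).mono (Ioi_subset_Ioi hX₂a.le)).aestronglyMeasurable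
      measurableSet_Ioi) ?_
    filter_upwards [ae_restrict_mem measurableSet_Ioi] with x hx
    have hx0 : 0 < x := hX₂0.trans hx
    have hb := hPB x (hX₂1.trans (le_of_lt hx))
    rw [Real.norm_eq_abs, abs_mul, abs_of_nonneg (sq_nonneg (h x))]
    have e : |P x| * h x ^ 2 = |x ^ 2 * P x| * (h x / x) ^ 2 := by
      rw [abs_mul, abs_of_nonneg (sq_nonneg x)]
      field_simp
    rw [e]
    exact mul_le_mul_of_nonneg_right hb (sq_nonneg _)
  have hUtB : ∀ x, X₁ ≤ x → |x ^ 2 * Ut x| ≤ 2 * B ^ 2 + C := by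
    intro x hx
    have e : x ^ 2 * Ut x = 2 * (x * W x) ^ 2 - x ^ 2 * U x := by rw [hUt x (haX.trans_le hx)]; ring
    rw [e]
    have h1 : |x * W x| ^ 2 ≤ B ^ 2 := pow_le_pow_left₀ (abs_nonneg _) (hWB x hx) 2
    rw [sq_abs] at h1
    calc |2 * (x * W x) ^ 2 - x ^ 2 * U x| ≤ |2 * (x * W x) ^ 2| + |x ^ 2 * U x| := abs_sub _ _
      _ ≤ 2 * B ^ 2 + C := by
          rw [abs_of_nonneg (by positivity)]
          linarith [hUB x hx]
  have hUf : IntegrableOn (fun x => U x * f x ^ 2) (Ioi xf) := hpot hUc hfc hUB hI3far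
  have hUtfu : IntegrableOn (fun x => Ut x * fu x ^ 2) (Ioi xf) := hpot hUtc hfuc hUtB hJ3'
  -- (3) the two static energy densities
  set e : ℝ → ℝ := fun x => (dfu x + W x * fu x) ^ 2 + df x ^ 2 + U x * f x ^ 2 with he_def
  set eu : ℝ → ℝ := fun x => gu x ^ 2 + dfu x ^ 2 + Ut x * fu x ^ 2 with heu_def
  have he : IntegrableOn e (Ioi xf) := (hg2.add hdf2).add hUf
  have heu : IntegrableOn eu (Ioi xf) := (hJ1.add hJ2).add hUtfu
  have hec : ContinuousOn e (Ioi a) := ((hgc.pow 2).add (hdfc.pow 2)).add (hUc.mul (hfc.pow 2))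
  have heuc : ContinuousOn eu (Ioi a) := ((hguc.pow 2).add (hdfuc.pow 2)).add (hUtc.mul (hfuc.pow 2))
  refine ⟨hg2, hdf2, hI3, he, heu, ?_⟩
  -- (4) the pointwise identity and its integral on `[xf, Y]`
  set b : ℝ → ℝ := fun x => W x * (f x ^ 2 + fu x ^ 2) with hb_def
  have hbd : ∀ x, a < x → HasDerivAt b (e x - eu x) x := by
    intro x hx
    have h := hasDerivAt_rung_boundary (ft := dfu x + W x * fu x) (gt := gu x) (hWd x hx) rfl (hUt x hx)
      (hf x hx) (hfu x hx) (by rw [hdf x hx]; ring) (by ring)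
    exact h
  have hint : ∀ Y, xf ≤ Y → ∫ x in xf..Y, eu x = (∫ x in xf..Y, e x) - b Y := by
    intro Y hY
    have hsub : ∀ x ∈ uIcc xf Y, a < x := fun x hx => by
      rw [uIcc_of_le hY] at hx; exact haxf.trans_le hx.1
    have hci : IntervalIntegrable (fun x => e x - eu x) volume xf Y :=
      ((hec.sub heuc).mono fun x hx => hsub x (by rw [uIcc_of_le hY]; exact hx)).intervalIntegrable_of_Icc hY
    have hftc := integral_eq_sub_of_hasDerivAt (fun x hx => hbd x (hsub x hx)) hci
    have hei : IntervalIntegrable e volume xf Y :=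
      (hec.mono fun x hx => hsub x (by rw [uIcc_of_le hY]; exact hx)).intervalIntegrable_of_Icc hY
    have heui : IntervalIntegrable eu volume xf Y :=
      (heuc.mono fun x hx => hsub x (by rw [uIcc_of_le hY]; exact hx)).intervalIntegrable_of_Icc hY
    rw [intervalIntegral.integral_sub hei heui] at hftc
    have hb0 : b xf = 0 := by simp [hb_def, hf0, hfu0]
    rw [hb0] at hftc
    linarith
  -- (5) the far edge term vanishes
  have hbY : Tendsto b atTop (𝓝 0) := by
    have hsq1 : Tendsto (fun Y => f Y ^ 2 / Y) atTop (𝓝 0) :=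
      tendsto_sq_div_self (f' := df) (X := xf) (fun y hy => hf y (haxf.trans_le hy))
        (hdfc.mono fun y hy => haxf.trans_le hy) hdf2
    have hsq2 : Tendsto (fun Y => fu Y ^ 2 / Y) atTop (𝓝 0) :=
      tendsto_sq_div_self (f' := dfu) (X := xf) (fun y hy => hfu y (haxf.trans_le hy))
        (hdfuc.mono fun y hy => haxf.trans_le hy) hJ2
    have hsum : Tendsto (fun Y => B * (f Y ^ 2 / Y + fu Y ^ 2 / Y)) atTop (𝓝 0) := by
      simpa using (hsq1.add hsq2).const_mul B
    refine squeeze_zero_norm' ?_ hsum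
    filter_upwards [Filter.eventually_ge_atTop X₂] with Y hY
    have hY1 : X₁ ≤ Y := hX₂1.trans hY
    have hY0 : 0 < Y := hX₂0.trans_le hY
    rw [Real.norm_eq_abs]
    have e1 : b Y = (Y * W Y) * (f Y ^ 2 / Y + fu Y ^ 2 / Y) := by
      simp only [hb_def]; field_simp
    rw [e1, abs_mul]
    exact (mul_le_mul_of_nonneg_right (hWB Y hY1) (abs_nonneg _)).trans
      (le_of_eq (by rw [abs_of_nonneg (by positivity)]))
  -- (6) pass to the limit
  have hlim_e := intervalIntegral_tendsto_integral_Ioi xf he tendsto_id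
  have hlim_eu := intervalIntegral_tendsto_integral_Ioi xf heu tendsto_id
  have hlim2 : Tendsto (fun Y => (∫ x in xf..id Y, e x) - b Y) atTop (𝓝 ((∫ x in Ioi xf, e x) - 0)) :=
    hlim_e.sub hbY
  have heq : ∫ x in Ioi xf, eu x = (∫ x in Ioi xf, e x) - 0 := by
    refine tendsto_nhds_unique hlim_eu (hlim2.congr' ?_)
    filter_upwards [Filter.eventually_ge_atTop xf] with Y hY
    exact (hint Y hY).symm
  rw [sub_zero] at heq
  exact heq.symm

/-- Registered sub-goal `peel_lowerDatum` of `stub_peel` (verbatim signature): the lower datum of a deficit rung is `w ∫_{xf} gu/w`. -/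
theorem peel_lowerDatum : ∀ (a xf : ℝ) (W w f df gu : ℝ → ℝ), a < xf → (∀ x, a < x → 0 < w x) → (∀ x, a < x → HasDerivAt w (W x * w x) x) → ContinuousOn gu (Set.Ioi a) → (∀ x, a < x → HasDerivAt f (df x) x) → (∀ x, a < x → df x = W x * f x + gu x) → f xf = 0 → ∀ x : ℝ, a < x → f x = w x * intervalIntegral (fun y => gu y / w y) xf x MeasureTheory.volume :=
  fun _ _ _ _ _ _ _ haxf hw0 hwd hguc hf hdf hf0 _ hx => lower_eq_seed_mul_primitive haxf hw0 hwd hguc hf hdf hf0 hx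

end Summit.FinalStateConjecture.FinalStateConjecture.Theorems.CrumPeelingRecessiveTower
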